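import Summits.AnomalousDissipation.AnomalousDissipation.Theorems.SolenoidalFractalHomogenisationLagrangianStepVmodFrameSolDefs
import Summits.AnomalousDissipation.AnomalousDissipation.Theorems.SolenoidalFractalHomogenisationLagrangianStepFrameExistsSol
import Summits.AnomalousDissipation.AnomalousDissipation.Theorems.SolenoidalFractalHomogenisationLagrangianStepFrameConjugacyOfModulation
import HarnessLib

/-!
# K1L_D (stmt-AnomalousDissipation-27980), v2 propagator spec (RULING D28-10 (c)): `FrameConjugacyAtFS` FROM THE FRAME-MODULATION DATUM — the providers
# `FrameConj.isDistortedPropagatorS_conjProp_clamped`, `frameConjugacyAtFS_of_curve / _of_clamped / _of_inputs / _of_modulation`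
(helper, `--supports 27980 --as helper`; prover lead-k1l-onelevel-p1 g7.)

`…FrameConjugacyF` (p720581) VERBATIM with the two distorted propagators in the v2 spec `IsDistortedPropagatorS` (= `IsDistortedPropagator ∧ exists_sol`,
`…VmodFrameSolDefs`).  The new field is supplied: for the clamped conjugate family by the hypothesis `hsol` of `isDistortedPropagatorS_conjProp_clamped`
(the clamp is the identity on `[0, a(t−s))`), for the two members by `exists_sol_true` / `exists_sol_coarse` (`…FrameExistsSol`: Lions ∘ time dilation ∘
the converse reading), so that `frameConjugacyAtFS_of_modulation` has EXACTLY the hypotheses of `frameConjugacyAtF_of_modulation` (the ellipticity of the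
two Eulerian tensors was already there for `hErepr`).
No sorry, no definition, no named fact.  NOT a proof of (M_θ), of `stub_Vmod_EHTthg`, of K1L_D or AD; rung F-D1.A0.
-/

set_option linter.dupNamespace false

noncomputable section

namespace Summit.AnomalousDissipation.AnomalousDissipation.Theorems.SolenoidalFractalHomogenisation.LagrangianStep.FrameConj

open Set Function Filter MeasureTheory Topology
open scoped NNReal ENNReal InnerProductSpace
open Literature.Analysis Literature.Analysis.FunctionSpaces Literature.Analysis.FunctionSpaces.Torus
open Literature.Analysis.FluidPDE Literature.Analysis.FluidPDE.LatticeShear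
open Literature.Analysis.FluidPDE.LatticeShear (LagrangianLatticeCarrier LatticeWord)
open Summit.AnomalousDissipation.AnomalousDissipation.Theorems.SolenoidalFractalHomogenisation.LagrangianStep.CellClauseMod
open Summit.AnomalousDissipation.AnomalousDissipation.Theorems.SolenoidalFractalHomogenisation.LagrangianStep.Z7Glue

variable {k : ℕ}

/-- **The clamped conjugate propagator satisfies the v2 spec** given EXISTENCE of distorted weak solutions along the clamped curve (`hsol`, stated
with the unclamped base frame like `hT1`; the clamp is the identity on `[0, a(t−s))`). -/
theorem isDistortedPropagatorS_conjProp_clamped (E : LagrangianLatticeCarrier k) (hR : E.LevelRegular) (m : ℕ) {s t : ℝ}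
    (hs0 : 0 ≤ s) (hst : s < t) (ht1 : t ≤ 1)
    {B bc : ℝ → VF} {𝔸E 𝔸c : Torus.Visc4 (Fin 3)} {U : ℝ → ℝ → (V2 →L[ℝ] V2)} (hU : Torus.IsPropagator 1 B 𝔸E U)
    (hL1 : ∀ (σ : ℝ) (u : V2),
      Torus.IsWeaklyDivFree (Torus.distort (frameG E m (s + σ / E.a (m + 1)) s) (⇑(frameRead E hR m s σ u) : VF)) ↔
        Torus.IsWeaklyDivFree (⇑u : VF))
    (hT1 : ∀ σ₁ : ℝ, 0 ≤ σ₁ → σ₁ < E.a (m + 1) * (t - s) → ∀ (φ : VF), MemLp φ 2 volume →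
      Torus.IsWeaklyDivFree (Torus.distort (frameG E m (s + σ₁ / E.a (m + 1)) s) φ) → ∀ w : ℝ → VF,
      Torus.IsWeakTensorPassiveVectorDistortedOn 0 (E.a (m + 1) * (t - s) - σ₁) 𝔸c (fun τ => bc (σ₁ + τ))
        (fun τ y => frameG E m (s + max 0 (min (σ₁ + τ) (E.a (m + 1) * (t - s))) / E.a (m + 1)) s y) φ w →
      Torus.IsWeakTensorPassiveVectorOn 0 (t - s - σ₁ / E.a (m + 1)) 𝔸E (fun τ' => B (s + σ₁ / E.a (m + 1) + τ'))
        (φ ∘ E.X m s (s + σ₁ / E.a (m + 1)))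
        (fun τ' x => w (E.a (m + 1) * τ') (E.X m s (s + σ₁ / E.a (m + 1) + τ') x)))
    (hErepr : ∀ t₁ : ℝ, s ≤ t₁ → t₁ < t → ∀ (φE : VF) (hφE : MemLp φE 2 volume), Torus.IsWeaklyDivFree φE → ∀ u : ℝ → VF,
      Torus.IsWeakTensorPassiveVectorOn 0 (t - t₁) 𝔸E (fun τ' => B (t₁ + τ')) φE u →
      ∀ᵐ τ' ∂(volume.restrict (Ioo 0 (t - t₁))), ∃ hτ : MemLp (u τ') 2 volume, hτ.toLp (u τ') = U t₁ (t₁ + τ') (hφE.toLp φE))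
    (hsol : ∀ σ₁ : ℝ, 0 ≤ σ₁ → σ₁ < E.a (m + 1) * (t - s) → ∀ (φ : VF), MemLp φ 2 volume →
      Torus.IsWeaklyDivFree (Torus.distort (frameG E m (s + σ₁ / E.a (m + 1)) s) φ) → ∃ w : ℝ → VF,
      Torus.IsWeakTensorPassiveVectorDistortedOn 0 (E.a (m + 1) * (t - s) - σ₁) 𝔸c (fun τ => bc (σ₁ + τ))
        (fun τ y => frameG E m (s + max 0 (min (σ₁ + τ) (E.a (m + 1) * (t - s))) / E.a (m + 1)) s y) φ w) :
    IsDistortedPropagatorS (E.a (m + 1) * (t - s)) 𝔸c bc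
      (fun τ y => frameG E m (s + max 0 (min τ (E.a (m + 1) * (t - s))) / E.a (m + 1)) s y)
      (fun σ₁ σ₂ => conjProp E hR m s U (max 0 (min σ₁ (E.a (m + 1) * (t - s)))) (max 0 (min σ₂ (E.a (m + 1) * (t - s))))) := by
  refine ⟨isDistortedPropagator_conjProp_clamped E hR m hs0 hst ht1 hU hL1 hT1 hErepr, fun σ₁ hσ₁0 hσ₁T φ hφ hdiv => ?_⟩
  have hcl : max 0 (min σ₁ (E.a (m + 1) * (t - s))) = σ₁ := by rw [min_eq_left hσ₁T.le, max_eq_right hσ₁0]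
  simp only [hcl] at hdiv
  exact hsol σ₁ hσ₁0 hσ₁T φ hφ hdiv

/-- **(T4)FS, general curve** — `frameConjugacyAt_of_curve` VERBATIM with a frame-modulation datum. -/
theorem frameConjugacyAtFS_of_curve {W : LatticeWord k} {M : ℝ} {hM : 0 < M} {c : ℝ} {Φ : ℝ → Torus.Visc4 (Fin 3) → Torus.Visc4 (Fin 3)}
    {Cα ϱ θ : ℝ} (E : LagrangianLatticeCarrier k) (hR : E.LevelRegular) (m : ℕ) (S : Torus.Visc4 (Fin 3)) {s t : ℝ}
    (hν : 0 < E.cellVisc (m + 1)) (hθ0 : 0 ≤ θ) (hθ : θ ≤ Cα * E.θ (m + 1)) (hϱ : 0 ≤ ϱ)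
    {G : ℝ → UnitAddTorus (Fin 3) → Matrix (Fin 3) (Fin 3) ℝ} (hmod : IsFrameModulation θ (E.a (m + 1) * (t - s)) (ϱ * E.N m) G)
    {Um Um1 Ut Tt : ℝ → ℝ → (V2 →L[ℝ] V2)}
    (hUt : IsDistortedPropagatorS (E.a (m + 1) * (t - s)) ((1 / (E.N (m + 1) : ℝ) ^ 2) • (E.cellVisc (m + 1) • S))
      (cellField W M hM (E.cellVisc (m + 1)) hν (E.N (m + 1))) G Ut)
    (hTt : IsDistortedPropagatorS (E.a (m + 1) * (t - s)) ((1 / (E.N (m + 1) : ℝ) ^ 2) • (E.cellVisc (m + 1) • S +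
      (c / E.cellVisc (m + 1)) • Φ (E.cellVisc (m + 1)) ((1 / E.cellVisc (m + 1)) • (E.cellVisc (m + 1) • S)))) (fun _ _ => 0) G Tt)
    (hU0 : ∀ x : V2, Ut 0 (E.a (m + 1) * (t - s)) x = frameRead E hR m s (E.a (m + 1) * (t - s)) (Um1 s t x))
    (hT0 : Tt 0 (E.a (m + 1) * (t - s)) = (frameRead E hR m s (E.a (m + 1) * (t - s))).comp (Um s t)) :
    FrameConjugacyAtFS W M hM c Φ Cα ϱ E m S Um1 Um s t := by
  have hT0' : ∀ x : V2, Tt 0 (E.a (m + 1) * (t - s)) x = frameRead E hR m s (E.a (m + 1) * (t - s)) (Um s t x) := fun x => by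
    rw [hT0, ContinuousLinearMap.comp_apply]
  refine ⟨⟨hν, by linarith⟩, θ, hθ0, hθ, ϱ * E.N m, by positivity, le_rfl, G, hmod, Ut, Tt, hUt, hTt,
    fun x => x, fun y => frameRead E hR m s (E.a (m + 1) * (t - s)) y, ?_, ?_, ?_⟩
  · intro x y _ _
    rw [hU0, hT0', ← map_sub, inner_frameRead]
  · intro x _
    unfold lossFwd
    rw [hT0', norm_frameRead]
  · intro y _
    unfold lossAdj
    rw [hT0, ContinuousLinearMap.adjoint_comp, ContinuousLinearMap.comp_apply, adjoint_frameRead_apply, norm_frameRead]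

/-- **(T4)FS, clamped exact-flow curve** — `frameConjugacyAt_of_clamped` with the frame-modulation datum taken DIRECTLY for the clamped curve
(no `congr` step: `IsFrameModulation` is stated for the clamped curve). -/
theorem frameConjugacyAtFS_of_clamped {W : LatticeWord k} {M : ℝ} {hM : 0 < M} {c : ℝ} {Φ : ℝ → Torus.Visc4 (Fin 3) → Torus.Visc4 (Fin 3)}
    {Cα ϱ θ : ℝ} (E : LagrangianLatticeCarrier k) (hR : E.LevelRegular) (m : ℕ) (S : Torus.Visc4 (Fin 3)) {s t : ℝ} (hst : s ≤ t)
    (hν : 0 < E.cellVisc (m + 1)) (hθ0 : 0 ≤ θ) (hθ : θ ≤ Cα * E.θ (m + 1)) (hϱ : 0 ≤ ϱ)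
    (hmod : IsFrameModulation θ (E.a (m + 1) * (t - s)) (ϱ * E.N m)
      (fun τ y => frameG E m (s + max 0 (min τ (E.a (m + 1) * (t - s))) / E.a (m + 1)) s y))
    {Um Um1 : ℝ → ℝ → (V2 →L[ℝ] V2)}
    (hUt : IsDistortedPropagatorS (E.a (m + 1) * (t - s)) ((1 / (E.N (m + 1) : ℝ) ^ 2) • (E.cellVisc (m + 1) • S))
      (cellField W M hM (E.cellVisc (m + 1)) hν (E.N (m + 1)))
      (fun τ y => frameG E m (s + max 0 (min τ (E.a (m + 1) * (t - s))) / E.a (m + 1)) s y)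
      (fun σ₁ σ₂ => conjProp E hR m s Um1 (max 0 (min σ₁ (E.a (m + 1) * (t - s)))) (max 0 (min σ₂ (E.a (m + 1) * (t - s))))))
    (hTt : IsDistortedPropagatorS (E.a (m + 1) * (t - s)) ((1 / (E.N (m + 1) : ℝ) ^ 2) • (E.cellVisc (m + 1) • S +
      (c / E.cellVisc (m + 1)) • Φ (E.cellVisc (m + 1)) ((1 / E.cellVisc (m + 1)) • (E.cellVisc (m + 1) • S)))) (fun _ _ => 0)
      (fun τ y => frameG E m (s + max 0 (min τ (E.a (m + 1) * (t - s))) / E.a (m + 1)) s y)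
      (fun σ₁ σ₂ => conjProp E hR m s Um (max 0 (min σ₁ (E.a (m + 1) * (t - s)))) (max 0 (min σ₂ (E.a (m + 1) * (t - s)))))) :
    FrameConjugacyAtFS W M hM c Φ Cα ϱ E m S Um1 Um s t := by
  have hTw : 0 ≤ E.a (m + 1) * (t - s) := mul_nonneg (E.a_pos (m + 1)).le (by linarith)
  have hc0 : max 0 (min 0 (E.a (m + 1) * (t - s))) = 0 := clamp_eq_self ⟨le_rfl, hTw⟩
  have hcT : max 0 (min (E.a (m + 1) * (t - s)) (E.a (m + 1) * (t - s))) = E.a (m + 1) * (t - s) := clamp_eq_self ⟨hTw, le_rfl⟩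
  refine frameConjugacyAtFS_of_curve E hR m S hν hθ0 hθ hϱ hmod hUt hTt (fun x => ?_) ?_
  · simp only [hc0, hcT]
    exact conjProp_zero_apply E hR m s t Um1 x
  · refine ContinuousLinearMap.ext fun x => ?_
    simp only [hc0, hcT, ContinuousLinearMap.comp_apply]
    exact conjProp_zero_apply E hR m s t Um x

/-- **`FrameConjugacyAtFS` on a closed piece from the frame-modulation datum of the CLAMPED curve, the Eulerian representation property and
EXISTENCE of distorted weak solutions for the two members** (`frameConjugacyAtF_of_inputs` VERBATIM otherwise). -/
theorem frameConjugacyAtFS_of_inputs (E : LagrangianLatticeCarrier k) (hL : E.LPermissible) (hR : E.LevelRegular) {W : LatticeWord k}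
    {M : ℝ} {hM : 0 < M} (hdes : E.design = W.stretch M hM) (Φ : ℝ → Torus.Visc4 (Fin 3) → Torus.Visc4 (Fin 3))
    {Cα ϱ θ : ℝ} (m j : ℕ) (S : Torus.Visc4 (Fin 3)) {t : ℝ}
    (hj0 : 0 ≤ (j : ℝ) * E.refresh (m + 1)) (hjt : (j : ℝ) * E.refresh (m + 1) < t)
    (htR : t ≤ (j : ℝ) * E.refresh (m + 1) + E.refresh (m + 1)) (ht1 : t ≤ 1)
    (hν : 0 < E.cellVisc (m + 1)) (hθ0 : 0 ≤ θ) (hθ : θ ≤ Cα * E.θ (m + 1)) (hϱ : 0 ≤ ϱ)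
    (hmod : IsFrameModulation θ (E.a (m + 1) * (t - (j : ℝ) * E.refresh (m + 1))) (ϱ * E.N m)
      (fun τ y => frameG E m ((j : ℝ) * E.refresh (m + 1)
        + max 0 (min τ (E.a (m + 1) * (t - (j : ℝ) * E.refresh (m + 1)))) / E.a (m + 1)) ((j : ℝ) * E.refresh (m + 1)) y))
    {Um Um1 : ℝ → ℝ → (V2 →L[ℝ] V2)}
    (hU1 : Torus.IsPropagator 1 (E.partialSum (m + 1)) (E.kbar (m + 1) • S) Um1)
    (hU : Torus.IsPropagator 1 (E.partialSum m) (E.kbar m • renormStep (Φ (E.cellVisc (m + 1))) (E.gain / E.cellVisc (m + 1) ^ 2) S) Um)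
    (hErepr1 : ∀ t₁ : ℝ, (j : ℝ) * E.refresh (m + 1) ≤ t₁ → t₁ < t → ∀ (φE : VF) (hφE : MemLp φE 2 volume),
      Torus.IsWeaklyDivFree φE → ∀ u : ℝ → VF,
      Torus.IsWeakTensorPassiveVectorOn 0 (t - t₁) (E.kbar (m + 1) • S) (fun τ' => E.partialSum (m + 1) (t₁ + τ')) φE u →
      ∀ᵐ τ' ∂(volume.restrict (Ioo 0 (t - t₁))), ∃ hτ : MemLp (u τ') 2 volume, hτ.toLp (u τ') = Um1 t₁ (t₁ + τ') (hφE.toLp φE))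
    (hErepr : ∀ t₁ : ℝ, (j : ℝ) * E.refresh (m + 1) ≤ t₁ → t₁ < t → ∀ (φE : VF) (hφE : MemLp φE 2 volume),
      Torus.IsWeaklyDivFree φE → ∀ u : ℝ → VF,
      Torus.IsWeakTensorPassiveVectorOn 0 (t - t₁) (E.kbar m • renormStep (Φ (E.cellVisc (m + 1))) (E.gain / E.cellVisc (m + 1) ^ 2) S)
        (fun τ' => E.partialSum m (t₁ + τ')) φE u →
      ∀ᵐ τ' ∂(volume.restrict (Ioo 0 (t - t₁))), ∃ hτ : MemLp (u τ') 2 volume, hτ.toLp (u τ') = Um t₁ (t₁ + τ') (hφE.toLp φE))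
    (hsol1 : ∀ σ₁ : ℝ, 0 ≤ σ₁ → σ₁ < E.a (m + 1) * (t - (j : ℝ) * E.refresh (m + 1)) →
      ∀ (φ : UnitAddTorus (Fin 3) → EuclideanSpace ℝ (Fin 3)), MemLp φ 2 volume →
      Torus.IsWeaklyDivFree (Torus.distort
        (frameG E m ((j : ℝ) * E.refresh (m + 1) + σ₁ / E.a (m + 1)) ((j : ℝ) * E.refresh (m + 1))) φ) →
      ∃ w : ℝ → UnitAddTorus (Fin 3) → EuclideanSpace ℝ (Fin 3),
      Torus.IsWeakTensorPassiveVectorDistortedOn 0 (E.a (m + 1) * (t - (j : ℝ) * E.refresh (m + 1)) - σ₁)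
        ((1 / (E.N (m + 1) : ℝ) ^ 2) • (E.cellVisc (m + 1) • S))
        (fun τ => cellField W M hM (E.cellVisc (m + 1)) hν (E.N (m + 1)) (σ₁ + τ))
        (fun τ y => frameG E m ((j : ℝ) * E.refresh (m + 1) +
          max 0 (min (σ₁ + τ) (E.a (m + 1) * (t - (j : ℝ) * E.refresh (m + 1)))) / E.a (m + 1)) ((j : ℝ) * E.refresh (m + 1)) y)
        φ w)
    (hsol : ∀ σ₁ : ℝ, 0 ≤ σ₁ → σ₁ < E.a (m + 1) * (t - (j : ℝ) * E.refresh (m + 1)) →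
      ∀ (φ : UnitAddTorus (Fin 3) → EuclideanSpace ℝ (Fin 3)), MemLp φ 2 volume →
      Torus.IsWeaklyDivFree (Torus.distort
        (frameG E m ((j : ℝ) * E.refresh (m + 1) + σ₁ / E.a (m + 1)) ((j : ℝ) * E.refresh (m + 1))) φ) →
      ∃ w : ℝ → UnitAddTorus (Fin 3) → EuclideanSpace ℝ (Fin 3),
      Torus.IsWeakTensorPassiveVectorDistortedOn 0 (E.a (m + 1) * (t - (j : ℝ) * E.refresh (m + 1)) - σ₁)
        ((1 / (E.N (m + 1) : ℝ) ^ 2) • (E.cellVisc (m + 1) • S +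
          (E.gain / E.cellVisc (m + 1)) • Φ (E.cellVisc (m + 1)) ((1 / E.cellVisc (m + 1)) • (E.cellVisc (m + 1) • S))))
        (fun τ => (fun (_ : ℝ) (_ : UnitAddTorus (Fin 3)) => (0 : EuclideanSpace ℝ (Fin 3))) (σ₁ + τ))
        (fun τ y => frameG E m ((j : ℝ) * E.refresh (m + 1) +
          max 0 (min (σ₁ + τ) (E.a (m + 1) * (t - (j : ℝ) * E.refresh (m + 1)))) / E.a (m + 1)) ((j : ℝ) * E.refresh (m + 1)) y)
        φ w) :
    FrameConjugacyAtFS W M hM E.gain Φ Cα ϱ E m S Um1 Um ((j : ℝ) * E.refresh (m + 1)) t := by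
  have hL1 : ∀ (σ : ℝ) (u : V2),
      Torus.IsWeaklyDivFree (Torus.distort (frameG E m ((j : ℝ) * E.refresh (m + 1) + σ / E.a (m + 1)) ((j : ℝ) * E.refresh (m + 1)))
        (⇑(frameRead E hR m ((j : ℝ) * E.refresh (m + 1)) σ u) : VF)) ↔ Torus.IsWeaklyDivFree (⇑u : VF) :=
    fun σ u => isWeaklyDivFree_distort_frameRead_iff' E hR m _ σ u
  have hUt := isDistortedPropagatorS_conjProp_clamped E hR m hj0 hjt ht1 hU1 hL1
    (𝔸c := (1 / (E.N (m + 1) : ℝ) ^ 2) • (E.cellVisc (m + 1) • S))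
    (bc := cellField W M hM (E.cellVisc (m + 1)) hν (E.N (m + 1)))
    (hT1_true E hL hR hdes m j hjt.le htR S hν) hErepr1 hsol1
  have hTt := isDistortedPropagatorS_conjProp_clamped E hR m hj0 hjt ht1 hU hL1
    (𝔸c := (1 / (E.N (m + 1) : ℝ) ^ 2) • (E.cellVisc (m + 1) • S +
      (E.gain / E.cellVisc (m + 1)) • Φ (E.cellVisc (m + 1)) ((1 / E.cellVisc (m + 1)) • (E.cellVisc (m + 1) • S))))
    (bc := fun (_ : ℝ) (_ : UnitAddTorus (Fin 3)) => (0 : EuclideanSpace ℝ (Fin 3)))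
    (hT1_coarse E hL hR m j hjt.le htR Φ S) hErepr hsol
  exact frameConjugacyAtFS_of_clamped E hR m S hjt.le hν hθ0 hθ hϱ hmod hUt hTt

/-- **`FrameConjugacyAtFS` from the frame-modulation datum alone** (`frameConjugacyAtF_of_modulation` VERBATIM: `hErepr` discharged by
`hErepr_partialSum`, `exists_sol` by `exists_sol_true` / `exists_sol_coarse`). -/
theorem frameConjugacyAtFS_of_modulation (E : LagrangianLatticeCarrier k) (hL : E.LPermissible) (hR : E.LevelRegular) {W : LatticeWord k}
    {M : ℝ} {hM : 0 < M} (hdes : E.design = W.stretch M hM) (Φ : ℝ → Torus.Visc4 (Fin 3) → Torus.Visc4 (Fin 3))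
    {Cα ϱ θ : ℝ} (m j : ℕ) (S : Torus.Visc4 (Fin 3)) {t : ℝ}
    (hj0 : 0 ≤ (j : ℝ) * E.refresh (m + 1)) (hjt : (j : ℝ) * E.refresh (m + 1) < t)
    (htR : t ≤ (j : ℝ) * E.refresh (m + 1) + E.refresh (m + 1)) (ht1 : t ≤ 1)
    (hν : 0 < E.cellVisc (m + 1)) (hθ0 : 0 ≤ θ) (hθ : θ ≤ Cα * E.θ (m + 1)) (hϱ : 0 ≤ ϱ)
    (hmod : IsFrameModulation θ (E.a (m + 1) * (t - (j : ℝ) * E.refresh (m + 1))) (ϱ * E.N m)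
      (fun τ y => frameG E m ((j : ℝ) * E.refresh (m + 1)
        + max 0 (min τ (E.a (m + 1) * (t - (j : ℝ) * E.refresh (m + 1)))) / E.a (m + 1)) ((j : ℝ) * E.refresh (m + 1)) y))
    {Um Um1 : ℝ → ℝ → (V2 →L[ℝ] V2)}
    (hU1 : Torus.IsPropagator 1 (E.partialSum (m + 1)) (E.kbar (m + 1) • S) Um1)
    (hU : Torus.IsPropagator 1 (E.partialSum m) (E.kbar m • renormStep (Φ (E.cellVisc (m + 1))) (E.gain / E.cellVisc (m + 1) ^ 2) S) Um)
    {lo₁ hi₁ lo₀ hi₀ : ℝ} (h𝔸1 : Torus.NearIso (E.kbar (m + 1) • S) lo₁ hi₁) (hlo₁ : 0 < lo₁)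
    (h𝔸0 : Torus.NearIso (E.kbar m • renormStep (Φ (E.cellVisc (m + 1))) (E.gain / E.cellVisc (m + 1) ^ 2) S) lo₀ hi₀) (hlo₀ : 0 < lo₀) :
    FrameConjugacyAtFS W M hM E.gain Φ Cα ϱ E m S Um1 Um ((j : ℝ) * E.refresh (m + 1)) t :=
  frameConjugacyAtFS_of_inputs E hL hR hdes Φ m j S hj0 hjt htR ht1 hν hθ0 hθ hϱ hmod hU1 hU
    (hErepr_partialSum E hR (m + 1) h𝔸1 hlo₁ hU1 hj0 ht1) (hErepr_partialSum E hR m h𝔸0 hlo₀ hU hj0 ht1)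
    (exists_sol_true E hL hR hdes m j hjt.le htR S hν h𝔸1 hlo₁) (exists_sol_coarse E hL hR m j hjt.le htR Φ S h𝔸0 hlo₀)

end Summit.AnomalousDissipation.AnomalousDissipation.Theorems.SolenoidalFractalHomogenisation.LagrangianStep.FrameConj

end
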